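import Mathlib.Analysis.SpecialFunctions.Log.Basic
import Mathlib.Data.Fintype.Pi
import Mathlib.Data.Fintype.Prod
import Mathlib.Order.Filter.AtTopBot.Basic
import Mathlib.Topology.Instances.Real.Lemmas
import HarnessLib

/-!
# The random `k`-SAT threshold is `2^k log 2 - O(k)` (Achlioptas–Peres 2004): the lower bound

A named fact (statement only): Theorem 2 of

* D. Achlioptas, Y. Peres, *The threshold for random k-SAT is `2^k log 2 - O(k)`*, J. Amer. Math.
  Soc. 17 (2004) 947–973 [AchlioptasPeres2004]; read in the authors' arXiv text cs/0305009
  (held, 24 pp.), whose Theorem 2 (p. 2) is: *"There exists a sequence `δ_k → 0` such that for all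
  `k ≥ 3`, `r_k ≥ 2^k log 2 - (k+1) log 2 / 2 - 1 - δ_k`"*, where (p. 1) `r_k ≡ sup{r : F_k(n, rn)`
  is satisfiable w.h.p.`}`, "w.h.p." = probability `→ 1` as `n → ∞` with `k` fixed, and `log` is the
  natural logarithm (title: "`2^k ln 2`").

THE MODEL (ibid. §1 p. 1 and §3 p. 8): `F_k(n, m)` has `m` i.i.d. clauses, each "the conjunction
[disjunction] of `k` i.i.d. random variables `ℓ_{ij}`, each `ℓ_{ij}` being a uniformly random
literal" among `x₁, …, xₙ, x̄₁, …, x̄ₙ`; clauses may be improper (repeated/contradictory literals),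
and (footnote †, §3) the results hold in all common models. This is the uniform measure on literal
arrays `Φ : Fin m → Fin k → Fin n × Bool` — the literal `(v, b)` being satisfied by `σ : Fin n → Bool`
iff `σ v = b` — which is exactly the typing used by route PneNP/OverlapGapAlgebra (and Bresler–Huang
2021, Def. 2.1); probabilities are counting ratios in `ℝ` (`litArraySatProb`), no measure theory.

RENDERING of "`r_k ≥ L_k`": since `Pr[F_k(n, m) satisfiable]` is non-increasing in `m` (the first `m`
clauses of `F_k(n, m+1)` are distributed as `F_k(n, m)`), `sup{r : F_k(n, rn) sat. w.h.p.} ≥ L_k` is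
equivalent to "for every `r < L_k`, `F_k(n, ⌊rn⌋)` is satisfiable w.h.p.", which is the form stated
(`m = ⌊r n⌋₊`; for `r < 0` the formula is empty and the statement trivial). Not here: Theorem 4
(the weaker factorised-weight bound `2^k log 2 - 2(k+1) log 2 - 1 - β_k`, p. 8), the first-moment
upper bound `r*_k ≤ 2^k log 2` (§1.1), Friedgut's theorem (Thm 3) and Corollary 1 ("uniformly positive
probability ⇒ `r_k ≥ r`"), the later sharpenings (Coja-Oghlan–Panagiotou 2016; Ding–Sly–Sun 2022,
`k ≥ k₀`). This fact grounds `Summit.PneNP.PneNP.Theses.OverlapGapAlgebra.PositiveSatProbability`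
(item stmt-PneNP-2464 = this fact at `r = 5 · 2^k log k / k`, which is below the bound for all large
`k` since `δ_k → 0`, weakened from "w.h.p." to "uniformly positive probability").
-/

noncomputable section

namespace Literature.Computability.Complexity

open Finset Filter
open scoped Classical

/-- Satisfiability of a literal array `Φ : Fin m → Fin k → Fin n × Bool` (clause `i` = the
disjunction of the `k` literals `Φ i j`; literal `(v, b)` is true under `σ` iff `σ v = b`): some
assignment makes, in every clause, some literal true (Achlioptas–Peres 2004, §1/§3 model).
[cite: AchlioptasPeres2004, §1 (p. 1) and §3 (p. 8) of arXiv:cs/0305009] -/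
def LitArraySat {m k n : ℕ} (Φ : Fin m → Fin k → Fin n × Bool) : Prop :=
  ∃ σ : Fin n → Bool, ∀ i : Fin m, ∃ j : Fin k, σ (Φ i j).1 = (Φ i j).2

/-- `Pr[F_k(n, m) is satisfiable]` in the with-replacement literal model: the fraction of
satisfiable literal arrays among all `(2n)^{km}` arrays `Fin m → Fin k → Fin n × Bool` (a counting
ratio in `ℝ`; `0/0 = 0` cannot occur since the array type is nonempty, even for `n = 0` when
`k·m = 0`, and for `n = 0 < k·m` the type is empty — junk `0`, irrelevant along `n → ∞`).
[cite: AchlioptasPeres2004, §1 (p. 1)] -/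
def litArraySatProb (k n m : ℕ) : ℝ :=
  ((univ.filter fun Φ : Fin m → Fin k → Fin n × Bool => LitArraySat Φ).card : ℝ) /
    Fintype.card (Fin m → Fin k → Fin n × Bool)

/-- **Achlioptas–Peres 2004, Theorem 2** (arXiv:cs/0305009 p. 2; JAMS 17 (2004)): *there exists
a sequence `δ_k → 0` such that for all `k ≥ 3`, `r_k ≥ 2^k log 2 - (k+1) log 2 / 2 - 1 - δ_k`*,
`r_k = sup{r : F_k(n, rn)` satisfiable w.h.p.`}`. Rendered (see the module docstring for the
equivalence via monotonicity in `m`): there is `δ : ℕ → ℝ` with `δ_k → 0` such that for every `k ≥ 3`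
and every real `r < 2^k log 2 - (k+1) log 2 / 2 - 1 - δ_k`, the probability that `F_k(n, ⌊r n⌋)` is
satisfiable tends to `1` as `n → ∞` (`log` = natural logarithm). Users take
`(h : AchlioptasPeres2004_threshold_lower_bound)`.
[cite: AchlioptasPeres2004, Thm. 2 (arXiv:cs/0305009 p. 2)] -/
def AchlioptasPeres2004_threshold_lower_bound : Prop :=
  ∃ δ : ℕ → ℝ, Tendsto δ atTop (nhds 0) ∧ ∀ k : ℕ, 3 ≤ k → ∀ r : ℝ,
    r < 2 ^ k * Real.log 2 - ((k : ℝ) + 1) * Real.log 2 / 2 - 1 - δ k →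
      Tendsto (fun n : ℕ => litArraySatProb k n ⌊r * n⌋₊) atTop (nhds 1)

end Literature.Computability.Complexity

end
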